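import Summits.Ventures.Crystal3D.Theorems.StickyWulffConstantPolycrystalWulffBoundTwoClassMerge
import Summits.Ventures.Crystal3D.Theorems.StickyWulffConstantPolycrystalWulffBoundPolyClosure

/-!
# `PolycrystalWulffBound`, line `PolyDensity`: REDUCTION of two-body textures to the TWO-GRAIN
# (two-phase) inequality (crux `stmt-Ventures-19482`; memo P-L2-g15 §5(7))

Route `StickyWulffConstant` of the venture `Summits/Ventures/Crystal3D`, second prover lane (poly-p2,
gen 15).  `polyBound_of_twoGrain`: if the polycrystal Wulff bound holds for every TWO-GRAIN polyhedral
texture `(S₁, S₂)` with bodies `W₁, W₂`, cross kernel `D₀` and cross charge `c₀` —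

  `6·2^{1/3}(√2·|S₁ ∪ S₂|)^{2/3} ≤ [per W₁ S₁ − ι_{W₁}(S₁,S₂)] + [per W₂ S₂ − ι_{W₂}(S₂,S₁)] + c₀·ι_{D₀}(S₁,S₂)` —

then it holds for EVERY polyhedral texture whose grains carry only the two bodies `W₁, W₂` (class map
`cls`), with arbitrary non-negatively charged same-class walls and cross-class walls charged `≥ c₀`
against `D₀` (`energy_twoClassMerged_le` + `poly_biUnion`, the latter from `poly_union` / `empty_eq_iUnion_polytope`).  With `W₂ = R_m^π W₁` (the twin body),
`D₀ = Dsc m`, `c₀ = ½` this is the booked statement «the SINGLE-AXIS case of the crux (all n, all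
inclinations, all cycles) ⇐ the two-phase twin inequality» (co-axial fcc lattices have exactly these two
bodies, `cruxWulffBody_eq_or_eq_reflection_image`).
WHAT THIS IS NOT: the two-grain inequality; the crux is not claimed.
-/

noncomputable section

namespace Summit.Ventures.Crystal3D.Theorems

open MeasureTheory Set Metric
open scoped RealInnerProductSpace ENNReal Pointwise
open Summit.Ventures.Crystal3D.Cruxes.TextureLiminf.TexShadow
open Literature.Analysis.Convexity

/-- **Finite unions of polyhedral grains are polyhedral**: `⋃_{f ∈ I} G f` is `Poly`. -/
theorem poly_biUnion {n : ℕ} (G : Fin n → Set E3)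
    (hPoly : ∀ f, ∃ (k : ℕ) (H : Fin k → Finset (E3 × ℝ)), G f = ⋃ i, polytope (H i))
    (I : Finset (Fin n)) :
    ∃ (k : ℕ) (H : Fin k → Finset (E3 × ℝ)), (⋃ f ∈ I, G f) = ⋃ i, polytope (H i) := by
  classical
  induction I using Finset.induction_on with
  | empty => simpa using empty_eq_iUnion_polytope
  | insert g I hg ih =>
    rw [Finset.set_biUnion_insert]
    exact poly_union (hPoly g) ih

/-- **Reduction to two grains.**  If the bound holds for every two-grain polyhedral texture with
bodies `W₁` (grain 1), `W₂` (grain 2), cross kernel `D₀` and cross charge `c₀`, then it holds for every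
polyhedral texture with two body classes, non-negative same-class charges and cross charges `≥ c₀`
against `D₀`. -/
theorem polyBound_of_twoGrain (W₁ W₂ D₀ : Set E3)
    (hW₁c : IsCompact W₁) (hW₁v : Convex ℝ W₁) (hW₁0 : (0 : E3) ∈ W₁) (hW₁s : -W₁ = W₁)
    (hW₂c : IsCompact W₂) (hW₂v : Convex ℝ W₂) (hW₂0 : (0 : E3) ∈ W₂) (hW₂s : -W₂ = W₂)
    (hD₀c : IsCompact D₀) (hD₀v : Convex ℝ D₀) (hD₀0 : (0 : E3) ∈ D₀) (hD₀s : -D₀ = D₀) (c₀ : ℝ)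
    (H2 : ∀ (S₁ S₂ : Set E3),
      (∃ (k : ℕ) (H : Fin k → Finset (E3 × ℝ)), S₁ = ⋃ i, polytope (H i)) →
      (∃ (k : ℕ) (H : Fin k → Finset (E3 × ℝ)), S₂ = ⋃ i, polytope (H i)) →
      volume S₁ < ⊤ → volume S₂ < ⊤ → Disjoint S₁ S₂ →
        6 * (2 : ℝ) ^ ((1 : ℝ) / 3) * (Real.sqrt 2 * (volume (S₁ ∪ S₂)).toReal) ^ ((2 : ℝ) / 3) ≤
          (per W₁ S₁ - (per W₁ S₁ + per W₁ S₂ - per W₁ (S₁ ∪ S₂)) / 2) +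
          (per W₂ S₂ - (per W₂ S₂ + per W₂ S₁ - per W₂ (S₂ ∪ S₁)) / 2) +
          c₀ * ((per D₀ S₁ + per D₀ S₂ - per D₀ (S₁ ∪ S₂)) / 2))
    {n : ℕ} (G : Fin n → Set E3)
    (hPoly : ∀ f, ∃ (k : ℕ) (H : Fin k → Finset (E3 × ℝ)), G f = ⋃ i, polytope (H i))
    (hvol : ∀ f, volume (G f) < ⊤) (hdisjG : ∀ f g, f ≠ g → Disjoint (G f) (G g))
    (cls : Fin n → Bool)
    (D : Fin n → Fin n → Set E3) (hDc : ∀ f g, IsCompact (D f g)) (hDv : ∀ f g, Convex ℝ (D f g))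
    (hD0 : ∀ f g, (0 : E3) ∈ D f g) (hDD₀ : ∀ f g, cls f ≠ cls g → D f g = D₀)
    (c : Fin n → Fin n → ℝ) (hc0 : ∀ f g, f ≠ g → 0 ≤ c f g) (hcc₀ : ∀ f g, cls f ≠ cls g → c₀ ≤ c f g) :
    6 * (2 : ℝ) ^ ((1 : ℝ) / 3) * (Real.sqrt 2 * (volume (⋃ f, G f)).toReal) ^ ((2 : ℝ) / 3) ≤
      (∑ f, (per (if cls f then W₁ else W₂) (G f) - ∑ g, (if f = g then 0 else
        (per (if cls f then W₁ else W₂) (G f) + per (if cls f then W₁ else W₂) (G g) -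
          per (if cls f then W₁ else W₂) (G f ∪ G g)) / 2))) +
      ∑ f, ∑ g, (if f = g then 0 else
        c f g / 2 * ((per (D f g) (G f) + per (D f g) (G g) - per (D f g) (G f ∪ G g)) / 2)) := by
  classical
  set K : Bool → Set E3 := fun b => if b then W₁ else W₂ with hK
  have hKc : ∀ b, IsCompact (K b) := fun b => by cases b <;> simp [hK, hW₁c, hW₂c]
  have hKv : ∀ b, Convex ℝ (K b) := fun b => by cases b <;> simp [hK, hW₁v, hW₂v]
  have hK0 : ∀ b, (0 : E3) ∈ K b := fun b => by cases b <;> simp [hK, hW₁0, hW₂0]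
  have hKs : ∀ b, -K b = K b := fun b => by cases b <;> simp [hK, hW₁s, hW₂s]
  set I : Finset (Fin n) := Finset.univ.filter (fun f => cls f = true) with hI
  set J : Finset (Fin n) := Finset.univ.filter (fun f => cls f = false) with hJ
  set S₁ : Set E3 := ⋃ f ∈ I, G f with hS₁
  set S₂ : Set E3 := ⋃ f ∈ J, G f with hS₂
  -- the merged texture is a two-grain polyhedral texture
  have hP₁ := poly_biUnion G hPoly I
  have hP₂ := poly_biUnion G hPoly J
  have hv₁ : volume S₁ < ⊤ := by
    refine lt_of_le_of_lt (measure_biUnion_finset_le I G) ?_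
    exact ENNReal.sum_lt_top.2 fun f _ => hvol f
  have hv₂ : volume S₂ < ⊤ := by
    refine lt_of_le_of_lt (measure_biUnion_finset_le J G) ?_
    exact ENNReal.sum_lt_top.2 fun f _ => hvol f
  have hd : Disjoint S₁ S₂ := by
    rw [hS₁, hS₂, Set.disjoint_left]
    intro x hx hx'
    obtain ⟨f, hf, hxf⟩ := mem_iUnion₂.1 hx
    obtain ⟨g, hg, hxg⟩ := mem_iUnion₂.1 hx'
    have hcf : cls f = true := (Finset.mem_filter.1 hf).2
    have hcg : cls g = false := (Finset.mem_filter.1 hg).2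
    have hfg : f ≠ g := fun h => by rw [h, hcg] at hcf; exact absurd hcf (by decide)
    exact Set.disjoint_left.1 (hdisjG f g hfg) hxf hxg
  have hU : (⋃ f, G f) = S₁ ∪ S₂ := by
    ext x
    simp only [mem_iUnion, mem_union, hS₁, hS₂, hI, hJ, Finset.mem_filter,
      Finset.mem_univ, true_and, exists_prop]
    constructor
    · rintro ⟨f, hx⟩
      cases h : cls f
      · exact Or.inr ⟨f, h, hx⟩
      · exact Or.inl ⟨f, h, hx⟩
    · rintro (⟨f, -, hx⟩ | ⟨f, -, hx⟩) <;> exact ⟨f, hx⟩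
  have h2 := H2 S₁ S₂ hP₁ hP₂ hv₁ hv₂ hd
  have hmerge := energy_twoClassMerged_le G hPoly hvol hdisjG cls K hKc hKv hK0 hKs D hDc hDv hD0
    D₀ hD₀c hD₀v hD₀0 hD₀s hDD₀ c hc0 c₀ hcc₀
  have hKt : K true = W₁ := by simp [hK]
  have hKf : K false = W₂ := by simp [hK]
  rw [hKt, hKf] at hmerge
  rw [hU]
  exact h2.trans hmerge

end Summit.Ventures.Crystal3D.Theorems

end
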